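import Summits.CriticalPhenomena.PercolationContinuityZ3.Theorems.Transplant.SiteTwoMaxArea
import Mathlib.GroupTheory.SemidirectProduct
import Mathlib.Algebra.BigOperators.Group.Finset.Basic
import HarnessLib

/-!
# THE TWIST CRITERION behind the type-number bound: a group containing an element whose conjugation on an abelian normal subgroup of finite exponent-index
# has only DEPENDENT fixed points carries NO `ℤ²`-character of rank two; hence in `N ⋊ F` (`F` of finite exponent, every `f ≠ 1` with dependent fixed points
# on `N`) every subgroup with a rank-two character lies in `N` — type number `≥ |F|` on a GRR

builds on p205010 (kernel theorem, internal audit signed; external expert review pending) — nothing in this file uses p205010; UNCONDITIONAL pure group theory;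
nothing is claimed about any open node.  Lane `prim-bschramm`, seat `prim-bschramm-p4` gen 28 (PART C3 of `P4-GENERAL.md` §50.10).  Helper file
(`--supports stmt-CriticalPhenomena-4575 --as helper`); def-free.

`AutEndStateTypes` proved the type-number bound for the family `ℤ^p ⋊ C_p` by an averaging argument written out on `ℤ^p`.  This file isolates the argument as a
CRITERION, so that every split crystallographic group can be fed in (the point groups of the plane: `p2 → 2`, `p3 → 3`, `p4 → 4`, `p6 → 6`, `pmm → 4`, `p4m → 8`,
`p6m → 12` types on a GRR — instances are one fixed-point computation each; not typed here):
* **`Twist.det2_eq_zero_of_fixed`** (the averaging lemma) — `Λ` abelian, `τ ∈ Aut(Λ)` with `τ^m = 1` (`m ≥ 1`), `ψ : Λ → ℤ²` a `τ`-INVARIANT character, and every two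
  `τ`-fixed elements DEPENDENT (`v^k = w^l`, `(k,l) ≠ 0`) ⟹ every two values of `ψ` have `det = 0`: the norm `N(v) = ∏_{j<m} τ^j v` is `τ`-fixed and `ψ(N v) = ψ(v)^m`.
* **`Twist.det2_eq_zero_of_conj`** — a group `A` with an abelian normal subgroup `Λ` containing all `e`-th powers (`e ≥ 1`) and an element `a` whose conjugation has
  only dependent fixed points on `Λ` carries NO `ℤ²`-character of rank two (`c(x)^e = c(x^e)` lands in `ψ(Λ)`).
* **`Twist.le_ker_of_rankTwo`** — `Γ = N ⋊[φ] F`, `N` abelian, `F` of finite exponent, and for every `f ≠ 1` the fixed points of `φ f` on `N` pairwise dependent ⟹ every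
  subgroup `A₀ ≤ Γ` with a rank-two `ℤ²`-character lies in `N = ker(Γ → F)`; `Twist.dvd_index` — `Nat.card F ∣ [Γ : A₀]` for finite `F` (so `≥ |F|` orbits: with
  `AutEndStateTypes`' GRR transfer, `≥ |F|` types).  `ZWr.le_ker_of_rankTwo` is the instance `N = ℤ^p`, `F = C_p` (fixed vectors of a non-zero shift are constant).
[cite: BenjaminiSchramm1996, Conj. 4; §2 (Cayley graphs; almost transitive graphs)] [cite: MilnorSolvableGrowth1968, Lemma 1]
-/

noncomputable section

namespace Summit.CriticalPhenomena.PercolationContinuityZ3.Theorems.Transplant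

open Literature.Probability.LatticeModels
open scoped Classical

namespace Twist

/-! ## §1 The averaging lemma on an abelian group with a finite-order automorphism -/

section Averaging

variable {Λ : Type} [CommGroup Λ] (τ : Λ ≃* Λ)

/-- Powers of an automorphism, applied: `τ^(j+1) v = τ (τ^j v)`. [folklore] -/
theorem pow_succ_apply (j : ℕ) (v : Λ) : (τ ^ (j + 1)) v = τ ((τ ^ j) v) := by
  rw [pow_succ', MulAut.mul_apply]

/-- A `τ`-invariant function is invariant under all powers of `τ`. [folklore] -/
theorem invariant_pow {β : Type} (ψ : Λ → β) (hψ : ∀ v, ψ (τ v) = ψ v) (j : ℕ) (v : Λ) : ψ ((τ ^ j) v) = ψ v := by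
  induction j with
  | zero => rw [pow_zero, MulAut.one_apply]
  | succ j ih => rw [pow_succ_apply, hψ, ih]

/-- **The norm `∏_{j<m} τ^j v` is `τ`-fixed when `τ^m = 1`.** [folklore] -/
theorem norm_fixed (m : ℕ) (hτ : ∀ v, (τ ^ m) v = v) (v : Λ) :
    τ (∏ j ∈ Finset.range m, (τ ^ j) v) = ∏ j ∈ Finset.range m, (τ ^ j) v := by
  rw [map_prod]
  have h1 : ∏ j ∈ Finset.range m, τ ((τ ^ j) v) = ∏ j ∈ Finset.range m, (τ ^ (j + 1)) v :=
    Finset.prod_congr rfl fun j _ => (pow_succ_apply τ j v).symm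
  rw [h1]
  have h2 := Finset.prod_range_succ (fun j => (τ ^ j) v) m
  have h3 := Finset.prod_range_succ' (fun j => (τ ^ j) v) m
  rw [h2, hτ v, pow_zero, MulAut.one_apply] at h3
  exact (mul_right_cancel h3).symm

/-- **A `τ`-invariant character takes the value `ψ(v)^m` on the norm.** [folklore] -/
theorem char_norm {M : Type} [CommMonoid M] (ψ : Λ →* M) (hψ : ∀ v, ψ (τ v) = ψ v) (m : ℕ) (v : Λ) :
    ψ (∏ j ∈ Finset.range m, (τ ^ j) v) = ψ v ^ m := by
  rw [map_prod]
  have h1 : ∏ j ∈ Finset.range m, ψ ((τ ^ j) v) = ∏ j ∈ Finset.range m, ψ v :=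
    Finset.prod_congr rfl fun j _ => invariant_pow τ ψ hψ j v
  rw [h1, Finset.prod_const, Finset.card_range]

/-- `det(u, k•v) = k·det(u, v)` and `det(k•u, v) = k·det(u, v)`. [folklore] -/
theorem det2_smul (k : ℤ) (u v : Site 2) :
    MaxArea.det2 u (k • v) = k * MaxArea.det2 u v ∧ MaxArea.det2 (k • u) v = k * MaxArea.det2 u v := by
  unfold MaxArea.det2; simp only [Pi.smul_apply, smul_eq_mul]; constructor <;> ring

/-- **THE AVERAGING LEMMA.**  `τ ∈ Aut(Λ)` with `τ^m = 1` (`m ≥ 1`), `ψ : Λ → ℤ²` a `τ`-invariant character, every two `τ`-fixed elements of `Λ` dependent ⟹ every two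
values of `ψ` have determinant zero. [cite: MilnorSolvableGrowth1968, Lemma 1] -/
theorem det2_eq_zero_of_fixed (m : ℕ) (hm : 0 < m) (hτ : ∀ v, (τ ^ m) v = v) (ψ : Λ →* Multiplicative (Site 2)) (hψ : ∀ v, ψ (τ v) = ψ v)
    (hfix : ∀ v w : Λ, τ v = v → τ w = w → ∃ k l : ℤ, (k ≠ 0 ∨ l ≠ 0) ∧ v ^ k = w ^ l) (v w : Λ) :
    MaxArea.det2 (Multiplicative.toAdd (ψ v)) (Multiplicative.toAdd (ψ w)) = 0 := by
  have hm' : (m : ℤ) ≠ 0 := by exact_mod_cast hm.ne'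
  obtain ⟨k, l, hkl, heq⟩ := hfix _ _ (norm_fixed τ m hτ v) (norm_fixed τ m hτ w)
  have h := congrArg (fun z => Multiplicative.toAdd (ψ z)) heq
  simp only [map_zpow, char_norm τ ψ hψ, toAdd_zpow, toAdd_pow, ← natCast_zsmul, smul_smul] at h
  -- `h : (k * m) • V = (l * m) • W`
  set V := Multiplicative.toAdd (ψ v)
  set W := Multiplicative.toAdd (ψ w)
  rcases hkl with hk | hl
  · have h1 : (k * m) * MaxArea.det2 V W = 0 := by
      rw [← (det2_smul (k * m) V W).2, h, (det2_smul (l * m) W W).2, MaxArea.det2_self, mul_zero]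
    exact (mul_eq_zero.1 h1).resolve_left (mul_ne_zero hk hm')
  · by_cases hk : k = 0
    · rw [hk, zero_mul, zero_smul] at h
      have hW : W = 0 := by
        rcases smul_eq_zero.1 h.symm with h0 | h0
        · exact absurd h0 (mul_ne_zero hl hm')
        · exact h0
      rw [hW, MaxArea.det2_zero_right]
    · have h1 : (k * m) * MaxArea.det2 V W = 0 := by
        rw [← (det2_smul (k * m) V W).2, h, (det2_smul (l * m) W W).2, MaxArea.det2_self, mul_zero]
      exact (mul_eq_zero.1 h1).resolve_left (mul_ne_zero hk hm')

end Averaging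

/-! ## §2 A group with a twisting element carries no rank-two character -/

/-- **THEOREM (the twist criterion).**  `A` a group, `Λ ≤ A` an ABELIAN NORMAL subgroup containing all `e`-th powers (`e ≥ 1`), `a ∈ A` such that every two elements of `Λ`
fixed by conjugation by `a` are dependent.  Then every homomorphism `c : A → ℤ²` has pairwise dependent values — no rank two. [cite: MilnorSolvableGrowth1968, Lemma 1] -/
theorem det2_eq_zero_of_conj {A : Type} [Group A] (Λ : Subgroup A) (hcomm : ∀ x ∈ Λ, ∀ y ∈ Λ, x * y = y * x) [Λ.Normal]
    (e : ℕ) (he : 0 < e) (hexp : ∀ x : A, x ^ e ∈ Λ) (a : A)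
    (hfix : ∀ v ∈ Λ, ∀ w ∈ Λ, a * v * a⁻¹ = v → a * w * a⁻¹ = w → ∃ k l : ℤ, (k ≠ 0 ∨ l ≠ 0) ∧ v ^ k = w ^ l)
    (c : A →* Multiplicative (Site 2)) (x y : A) :
    MaxArea.det2 (Multiplicative.toAdd (c x)) (Multiplicative.toAdd (c y)) = 0 := by
  have he' : (e : ℤ) ≠ 0 := by exact_mod_cast he.ne'
  letI : CommGroup Λ := { (inferInstance : Group Λ) with mul_comm := fun u v => Subtype.ext (hcomm u u.2 v v.2) }
  -- conjugation by `a`, as an automorphism of `Λ`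
  let τ : Λ ≃* Λ :=
    { toFun := fun v => ⟨a * v * a⁻¹, Subgroup.Normal.conj_mem inferInstance (v : A) v.2 a⟩
      invFun := fun v => ⟨a⁻¹ * v * a⁻¹⁻¹, Subgroup.Normal.conj_mem inferInstance (v : A) v.2 a⁻¹⟩
      left_inv := fun v => Subtype.ext (by simp only [inv_inv]; group)
      right_inv := fun v => Subtype.ext (by simp only [inv_inv]; group)
      map_mul' := fun u v => Subtype.ext (by simp only [Subgroup.coe_mul]; group) }
  have hτ : ∀ v : Λ, ((τ v : Λ) : A) = a * v * a⁻¹ := fun v => rfl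
  have hτpow : ∀ (j : ℕ) (v : Λ), (((τ ^ j) v : Λ) : A) = a ^ j * v * (a ^ j)⁻¹ := by
    intro j v
    induction j with
    | zero => rw [pow_zero, MulAut.one_apply, pow_zero, one_mul, inv_one, mul_one]
    | succ j ih => rw [pow_succ_apply, hτ, ih, pow_succ']; group
  -- `τ^e = 1`: `a^e ∈ Λ` commutes with `Λ`
  have hτe : ∀ v : Λ, (τ ^ e) v = v := fun v => Subtype.ext (by
    rw [hτpow, hcomm _ (hexp a) _ v.2, mul_inv_cancel_right])
  -- the restricted character is `τ`-invariant
  let ψ : Λ →* Multiplicative (Site 2) := c.comp Λ.subtype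
  have hψ : ∀ v : Λ, ψ (τ v) = ψ v := fun v => by
    show c ((τ v : Λ) : A) = c (v : A)
    rw [hτ, map_mul, map_mul, map_inv, mul_inv_cancel_comm]
  have hfix' : ∀ v w : Λ, τ v = v → τ w = w → ∃ k l : ℤ, (k ≠ 0 ∨ l ≠ 0) ∧ v ^ k = w ^ l := by
    intro v w hv hw
    obtain ⟨k, l, hkl, h⟩ := hfix v v.2 w w.2 (by rw [← hτ, hv]) (by rw [← hτ, hw])
    exact ⟨k, l, hkl, Subtype.ext (by rw [Subgroup.coe_zpow, Subgroup.coe_zpow]; exact h)⟩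
  have key := det2_eq_zero_of_fixed τ e he hτe ψ hψ hfix' ⟨x ^ e, hexp x⟩ ⟨y ^ e, hexp y⟩
  have hx : Multiplicative.toAdd (ψ ⟨x ^ e, hexp x⟩) = (e : ℤ) • Multiplicative.toAdd (c x) := by
    show Multiplicative.toAdd (c (x ^ e)) = _; rw [map_pow, toAdd_pow, natCast_zsmul]
  have hy : Multiplicative.toAdd (ψ ⟨y ^ e, hexp y⟩) = (e : ℤ) • Multiplicative.toAdd (c y) := by
    show Multiplicative.toAdd (c (y ^ e)) = _; rw [map_pow, toAdd_pow, natCast_zsmul]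
  rw [hx, hy, (det2_smul _ _ _).2, (det2_smul _ _ _).1] at key
  exact (mul_eq_zero.1 ((mul_eq_zero.1 key).resolve_left he')).resolve_left he'

/-! ## §3 Split extensions `N ⋊ F`: subgroups with a rank-two character lie in `N` -/

section Split

variable {N F : Type} [CommGroup N] [Group F] {φ : F →* MulAut N}

/-- **Conjugation of `inl n` by `x` is `inl (φ x.right n)`** (`N` abelian). [folklore] -/
theorem conj_inl (x : N ⋊[φ] F) (n : N) : x * SemidirectProduct.inl n * x⁻¹ = SemidirectProduct.inl (φ x.right n) := by
  refine SemidirectProduct.ext ?_ ?_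
  · simp only [SemidirectProduct.mul_left, SemidirectProduct.mul_right, SemidirectProduct.left_inl, SemidirectProduct.right_inl,
      SemidirectProduct.inv_left, mul_one]
    rw [← MulAut.mul_apply, ← map_mul, mul_inv_cancel, map_one, MulAut.one_apply, mul_inv_cancel_comm]
  · simp only [SemidirectProduct.mul_right, SemidirectProduct.right_inl, SemidirectProduct.inv_right, mul_one, mul_inv_cancel]

/-- An element of `N ⋊ F` with trivial `F`-part is `inl` of its `N`-part. [folklore] -/
theorem eq_inl_of_right_eq_one {x : N ⋊[φ] F} (h : x.right = 1) : x = SemidirectProduct.inl x.left :=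
  SemidirectProduct.ext rfl h

/-- **THEOREM (split extensions).**  `N` abelian, `F` of finite exponent `e ≥ 1`, and for every `f ≠ 1` every two `φ f`-fixed elements of `N` dependent.  Then every
subgroup `A₀ ≤ N ⋊[φ] F` carrying a homomorphism to `ℤ²` of rank-two image lies in `N = ker(N ⋊ F → F)`.
[cite: BenjaminiSchramm1996, §2 (almost transitive graphs)] [cite: MilnorSolvableGrowth1968, Lemma 1] -/
theorem le_ker_of_rankTwo (e : ℕ) (he : 0 < e) (hexp : ∀ f : F, f ^ e = 1)
    (hfix : ∀ f : F, f ≠ 1 → ∀ v w : N, φ f v = v → φ f w = w → ∃ k l : ℤ, (k ≠ 0 ∨ l ≠ 0) ∧ v ^ k = w ^ l)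
    (A₀ : Subgroup (N ⋊[φ] F)) (c : A₀ →* Multiplicative (Site 2))
    (hrank : ∃ x y : A₀, MaxArea.det2 (Multiplicative.toAdd (c x)) (Multiplicative.toAdd (c y)) ≠ 0) :
    A₀ ≤ (SemidirectProduct.rightHom : N ⋊[φ] F →* F).ker := by
  by_contra hle
  obtain ⟨a₀, ha₀A, ha₀⟩ := (SetLike.not_le_iff_exists).1 hle
  rw [MonoidHom.mem_ker, SemidirectProduct.rightHom_eq_right] at ha₀
  -- the lattice part of `A₀`, as a normal abelian subgroup of `A₀`
  let Λ : Subgroup A₀ := (SemidirectProduct.rightHom : N ⋊[φ] F →* F).ker.comap A₀.subtype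
  have hmemΛ : ∀ x : A₀, x ∈ Λ ↔ (x : N ⋊[φ] F).right = 1 := fun x => by
    show (SemidirectProduct.rightHom ((A₀.subtype) x) = 1) ↔ _; rfl
  haveI : Λ.Normal := Subgroup.Normal.comap inferInstance _
  have hcomm : ∀ x ∈ Λ, ∀ y ∈ Λ, x * y = y * x := by
    intro x hx y hy
    apply Subtype.ext
    rw [Subgroup.coe_mul, Subgroup.coe_mul, eq_inl_of_right_eq_one ((hmemΛ x).1 hx), eq_inl_of_right_eq_one ((hmemΛ y).1 hy), ← map_mul, ← map_mul,
      mul_comm]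
  have hexpA : ∀ x : A₀, x ^ e ∈ Λ := fun x => by
    rw [hmemΛ, Subgroup.coe_pow, ← SemidirectProduct.rightHom_eq_right, map_pow, hexp]
  have hfixA : ∀ v ∈ Λ, ∀ w ∈ Λ, (⟨a₀, ha₀A⟩ : A₀) * v * (⟨a₀, ha₀A⟩ : A₀)⁻¹ = v → (⟨a₀, ha₀A⟩ : A₀) * w * (⟨a₀, ha₀A⟩ : A₀)⁻¹ = w →
      ∃ k l : ℤ, (k ≠ 0 ∨ l ≠ 0) ∧ v ^ k = w ^ l := by
    intro v hv w hw hav haw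
    have hv1 := eq_inl_of_right_eq_one ((hmemΛ v).1 hv)
    have hw1 := eq_inl_of_right_eq_one ((hmemΛ w).1 hw)
    have hav' : φ a₀.right (v : N ⋊[φ] F).left = (v : N ⋊[φ] F).left := by
      have h := congrArg Subtype.val hav
      simp only [Subgroup.coe_mul, Subgroup.coe_inv] at h
      rw [hv1, conj_inl, SemidirectProduct.inl_inj] at h
      exact h
    have haw' : φ a₀.right (w : N ⋊[φ] F).left = (w : N ⋊[φ] F).left := by
      have h := congrArg Subtype.val haw
      simp only [Subgroup.coe_mul, Subgroup.coe_inv] at h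
      rw [hw1, conj_inl, SemidirectProduct.inl_inj] at h
      exact h
    obtain ⟨k, l, hkl, h⟩ := hfix a₀.right ha₀ _ _ hav' haw'
    refine ⟨k, l, hkl, Subtype.ext ?_⟩
    rw [Subgroup.coe_zpow, Subgroup.coe_zpow, hv1, hw1, ← map_zpow, ← map_zpow, h]
  obtain ⟨x, y, hxy⟩ := hrank
  exact hxy (det2_eq_zero_of_conj Λ hcomm e he hexpA ⟨a₀, ha₀A⟩ hfixA c x y)

/-- **COROLLARY: `Nat.card F ∣ [N ⋊ F : A₀]`** for finite `F` (index `0` = infinite index included) — at least `|F|` orbits.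
[cite: BenjaminiSchramm1996, §2 (almost transitive graphs)] -/
theorem dvd_index [Finite F] (hfix : ∀ f : F, f ≠ 1 → ∀ v w : N, φ f v = v → φ f w = w → ∃ k l : ℤ, (k ≠ 0 ∨ l ≠ 0) ∧ v ^ k = w ^ l)
    (A₀ : Subgroup (N ⋊[φ] F)) (c : A₀ →* Multiplicative (Site 2))
    (hrank : ∃ x y : A₀, MaxArea.det2 (Multiplicative.toAdd (c x)) (Multiplicative.toAdd (c y)) ≠ 0) : Nat.card F ∣ A₀.index := by
  haveI : Fintype F := Fintype.ofFinite F
  have h := Subgroup.index_dvd_of_le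
    (le_ker_of_rankTwo (Fintype.card F) Fintype.card_pos (fun f => pow_card_eq_one) hfix A₀ c hrank)
  rwa [Subgroup.index_ker, MonoidHom.range_eq_top_of_surjective _ SemidirectProduct.rightHom_surjective, Subgroup.card_top] at h

/-- **COROLLARY: finite index ⟹ `[N ⋊ F : A₀] ≥ |F|`.** [cite: BenjaminiSchramm1996, §2 (almost transitive graphs)] -/
theorem le_index [Finite F] (hfix : ∀ f : F, f ≠ 1 → ∀ v w : N, φ f v = v → φ f w = w → ∃ k l : ℤ, (k ≠ 0 ∨ l ≠ 0) ∧ v ^ k = w ^ l)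
    (A₀ : Subgroup (N ⋊[φ] F)) [A₀.FiniteIndex] (c : A₀ →* Multiplicative (Site 2))
    (hrank : ∃ x y : A₀, MaxArea.det2 (Multiplicative.toAdd (c x)) (Multiplicative.toAdd (c y)) ≠ 0) : Nat.card F ≤ A₀.index :=
  Nat.le_of_dvd (Nat.pos_of_ne_zero Subgroup.FiniteIndex.index_ne_zero) (dvd_index hfix A₀ c hrank)

end Split

end Twist

end Summit.CriticalPhenomena.PercolationContinuityZ3.Theorems.Transplant

end
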